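import Summits.ValiantsHypothesis.ValiantsHypothesis.Theorems.LangWeilTransferTameResolutionAlgebra

/-!
# LangWeilTransfer, support item `TameResolution` (stmt-ValiantsHypothesis-6378) — differentiating
# the eliminant identity in the coefficients of the generic linear form

Route `LangWeilTransfer` of `ValiantsHypothesis` (conditional route; honest framing: bookkeeping,
nothing here bears on VP ≠ VNP). Step (P) of the architecture note of val-lit-p6 g9: an identity
`q(T̄, Λ, Σ_j Λ_j ξ_j) = 0` in `F[Λ]` (`q ∈ A₀[Λ][U]`, `A₀ = ℤ[T]`, `θ : A₀ → F` the evaluation at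
`T̄`) gives, by `∂/∂Λ_j`,
`(∂_U q)(T̄, Λ, u_Λ) · ξ_j + (∂_{Λ_j} q)(T̄, Λ, u_Λ) = 0` — the source of the parametrisation
`ξ_j = -∂_{Λ_j} q / ∂_U q` of the coordinates by the primitive element.

* `evalGeneric` point of view: `Φ = eval₂ (map θ) u_Λ : A₀[Λ][U] → F[Λ]`, `u_Λ = Σ_j ξ_j Λ_j`;
* `optionEquivLeft_pderiv_none` — the dictionary `A₀[Λ ⊔ {U}] ≅ A₀[Λ][U]` carries `∂/∂U` to
  `Polynomial.derivative`;
* `eval₂_optionEquivLeft_eq_aeval` — and evaluation `Φ` to `aeval`;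
* `derivative_identity` — **the differentiated identity** `Φ(q') · ξ_j + Φ(∂_{Λ_j} q) = 0`, with
  `∂_{Λ_j} q = optionEquivLeft (pderiv (some j) (optionEquivLeft.symm q))`.
-/

noncomputable section

open MvPolynomial

-- the summit and the problem share the name `ValiantsHypothesis` (D-0017 single-conjunct layout)
set_option linter.dupNamespace false

namespace Summit.ValiantsHypothesis.ValiantsHypothesis.Theorems.LangWeilTransfer

variable {A₀ F : Type*} [CommRing A₀] [CommRing F] {n : ℕ}

/-- The dictionary `A₀[X_{Option σ}] ≅ A₀[X_σ][U]` (`U = X none`) carries `∂/∂(X none)` to the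
derivative in `U`. -/
theorem optionEquivLeft_pderiv_none {σ : Type*} (q : MvPolynomial (Option σ) A₀) :
    optionEquivLeft A₀ σ (pderiv none q) = Polynomial.derivative (optionEquivLeft A₀ σ q) := by
  classical
  induction q using MvPolynomial.induction_on with
  | C a => rw [pderiv_C, map_zero, optionEquivLeft_C, Polynomial.derivative_C]
  | add p q hp hq => rw [map_add, map_add, hp, hq, map_add, Polynomial.derivative_add]
  | mul_X p v hp =>
    rw [Derivation.leibniz, smul_eq_mul, smul_eq_mul, map_add, map_mul, map_mul, hp, map_mul,
      Polynomial.derivative_mul]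
    cases v with
    | none =>
      rw [pderiv_X, Pi.single_eq_same, map_one, optionEquivLeft_X_none, Polynomial.derivative_X]
      ring
    | some j =>
      rw [pderiv_X, Pi.single_eq_of_ne (by simp), map_zero, optionEquivLeft_X_some,
        Polynomial.derivative_C]
      ring

/-- Evaluation through the dictionary: for `θ : A₀ → F` and `w ∈ F[X_σ]`,
`eval₂ (map θ) w (optionEquivLeft q) = aeval (none ↦ w, some s ↦ X s) (map θ q)`. -/
theorem eval₂_optionEquivLeft_eq_aeval {σ : Type*} (θ : A₀ →+* F) (w : MvPolynomial σ F)
    (q : MvPolynomial (Option σ) A₀) :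
    Polynomial.eval₂ (MvPolynomial.map θ) w (optionEquivLeft A₀ σ q) =
      aeval (fun o : Option σ => o.elim w X) (MvPolynomial.map θ q) := by
  have h : ((Polynomial.eval₂RingHom (MvPolynomial.map θ) w).comp
      (optionEquivLeft A₀ σ).toRingEquiv.toRingHom) =
      ((aeval (fun o : Option σ => o.elim w X)).toRingHom.comp (MvPolynomial.map θ)) := by
    refine MvPolynomial.ringHom_ext (fun a => ?_) (fun o => ?_)
    · simp only [RingHom.comp_apply, RingEquiv.toRingHom_eq_coe,
        AlgEquiv.toRingEquiv_toRingHom, RingHom.coe_coe, optionEquivLeft_C, Polynomial.coe_eval₂RingHom,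
        Polynomial.eval₂_C, map_C, AlgHom.toRingHom_eq_coe, aeval_C, algebraMap_eq]
    · cases o with
      | none =>
        simp only [RingHom.comp_apply, RingEquiv.toRingHom_eq_coe,
          AlgEquiv.toRingEquiv_toRingHom, RingHom.coe_coe, optionEquivLeft_X_none,
          Polynomial.coe_eval₂RingHom, Polynomial.eval₂_X, map_X, AlgHom.toRingHom_eq_coe, aeval_X,
          Option.elim_none]
      | some s =>
        simp only [RingHom.comp_apply, RingEquiv.toRingHom_eq_coe,
          AlgEquiv.toRingEquiv_toRingHom, RingHom.coe_coe, optionEquivLeft_X_some,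
          Polynomial.coe_eval₂RingHom, Polynomial.eval₂_C, map_X, AlgHom.toRingHom_eq_coe, aeval_X,
          Option.elim_some]
  exact congrArg (fun g => g q) h

/-- **The identity differentiated at the level of `A₀[X_{Option σ}]`.** If
`aeval f (map θ q) = 0` in `F[Λ]` with `f none = Σ_j ξ_j Λ_j`, `f (some j) = Λ_j`, then for each `j`:
`aeval f (map θ (∂_none q)) · ξ_j + aeval f (map θ (∂_{some j} q)) = 0` (chain rule). -/
theorem aeval_pderiv_identity (θ : A₀ →+* F) (ξ : Fin n → F) (q : MvPolynomial (Option (Fin n)) A₀)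
    (h : aeval (fun o : Option (Fin n) => o.elim (∑ j, C (ξ j) * X j) X) (MvPolynomial.map θ q) = 0)
    (j : Fin n) :
    aeval (fun o : Option (Fin n) => o.elim (∑ j, C (ξ j) * X j) X) (MvPolynomial.map θ (pderiv none q)) *
        C (ξ j) +
      aeval (fun o : Option (Fin n) => o.elim (∑ j, C (ξ j) * X j) X)
        (MvPolynomial.map θ (pderiv (some j) q)) = 0 := by
  classical
  set f : Option (Fin n) → MvPolynomial (Fin n) F := fun o => o.elim (∑ j, C (ξ j) * X j) X with hf
  have hD := congrArg (pderiv j) h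
  rw [map_zero, pderiv_aeval_eq_sum, Fintype.sum_option] at hD
  -- derivatives of the substitution
  have hnone : pderiv j (f none) = C (ξ j) := by
    simp only [hf, Option.elim_none, map_sum, pderiv_C_mul, pderiv_X]
    rw [Finset.sum_eq_single j]
    · rw [Pi.single_eq_same, mul_one]
    · intro b _ hb; rw [Pi.single_eq_of_ne hb, mul_zero]
    · intro hj; exact absurd (Finset.mem_univ j) hj
  have hsome : ∀ j', pderiv j (f (some j')) = if j' = j then 1 else 0 := by
    intro j'
    simp only [hf, Option.elim_some, pderiv_X]
    by_cases hjj : j' = j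
    · subst hjj; rw [Pi.single_eq_same, if_pos rfl]
    · rw [Pi.single_eq_of_ne hjj, if_neg hjj]
  simp only [hnone, hsome, mul_ite, mul_one, mul_zero, Finset.sum_ite_eq', Finset.mem_univ, if_true,
    pderiv_map] at hD
  exact hD

/-- **The differentiated eliminant identity** in the `A₀[Λ][U]` picture. Let `θ : A₀ → F`,
`ξ ∈ Fⁿ`, `u_Λ = Σ_j ξ_j Λ_j ∈ F[Λ]`, `Φ = eval₂ (map θ) u_Λ : A₀[Λ][U] → F[Λ]`, and `q ∈ A₀[Λ][U]`
with `Φ q = 0`. Then for every `j`,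
`Φ(q') · ξ_j + Φ(∂_{Λ_j} q) = 0`, where `q'` is the `U`-derivative and
`∂_{Λ_j} q = optionEquivLeft (pderiv (some j) (optionEquivLeft.symm q))`. -/
theorem derivative_identity (θ : A₀ →+* F) (ξ : Fin n → F) (q : Polynomial (MvPolynomial (Fin n) A₀))
    (h : Polynomial.eval₂ (MvPolynomial.map θ) (∑ j, C (ξ j) * X j) q = 0) (j : Fin n) :
    Polynomial.eval₂ (MvPolynomial.map θ) (∑ j, C (ξ j) * X j) (Polynomial.derivative q) * C (ξ j) +
      Polynomial.eval₂ (MvPolynomial.map θ) (∑ j, C (ξ j) * X j)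
        (optionEquivLeft A₀ (Fin n) (pderiv (some j) ((optionEquivLeft A₀ (Fin n)).symm q))) = 0 := by
  set qf := (optionEquivLeft A₀ (Fin n)).symm q with hqf
  have hq : q = optionEquivLeft A₀ (Fin n) qf := by rw [hqf, AlgEquiv.apply_symm_apply]
  have h' : aeval (fun o : Option (Fin n) => o.elim (∑ j, C (ξ j) * X j) X) (MvPolynomial.map θ qf) = 0 := by
    rw [← eval₂_optionEquivLeft_eq_aeval, ← hq]; exact h
  have hid := aeval_pderiv_identity θ ξ qf h' j
  rw [← eval₂_optionEquivLeft_eq_aeval, ← eval₂_optionEquivLeft_eq_aeval, optionEquivLeft_pderiv_none,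
    ← hq] at hid
  exact hid

end Summit.ValiantsHypothesis.ValiantsHypothesis.Theorems.LangWeilTransfer
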